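import Literature.Analysis.Calculus.CylinderHomotopyOperator
import Literature.NumberTheory.Transcendental.FormIntegrationCharts
import HarnessLib

/-!
# Homotopic maps pull back closed forms to cohomologous forms (Lee, Prop. 17.10, model case)

Topic `Analysis/Calculus`; namespace `Literature.Analysis.Calculus`.  Theorems only; no definition,
no named fact, no `sorry`.  Sequel of `CylinderHomotopyOperator.lean` (Lee, *Introduction to Smooth
Manifolds* (2012), Lemma 17.9: the cylinder operator `h` with `h(dω) + d(hω) = i₁^* ω - i₀^* ω`).
Here Lemma 17.9 is combined, as in the printed proof of Prop. 17.10 ("Because `F = H ∘ i₀` and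
`G = H ∘ i₁` … `G^* - F^* = (i₁^* - i₀^*) ∘ H^* = d ∘ (h ∘ H^*) + (h ∘ H^*) ∘ d`"), with the pull-back
along a homotopy `Φ : E × ℝ → E'` between `Φ₀ = Φ(·, 0)` and `Φ₁ = Φ(·, 1)`, on ARBITRARY real normed
spaces `E`, `E'` (forms with values in a complete space `F`, Mathlib's `extDeriv` formalism, the
pull-back of `β` along `Φ` written `p ↦ (β (Φ p)).compContinuousLinearMap (fderiv ℝ Φ p)` as in
Mathlib's `extDeriv_pullback`):

* `contDiffOn_pullbackForm` — `Φ^* β` is `Cᵐ` on an open `Ω` when `Φ` is `Cᵐ⁺¹` there and `β` is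
  `Cᵐ` on an open set through which `Φ` maps `Ω`;
* `pullbackForm_slice` — `i_t^*(Φ^* β) = (Φ ∘ i_t)^* β` (chain rule);
* `extDeriv_pullbackForm_eq_zero` — `d(Φ^* β) = Φ^*(dβ) = 0` on `Ω` for closed `β`
  (Mathlib's `extDeriv_pullback`);
* **`extDeriv_cylinderPrimitive_pullbackForm`** — for `β` closed of class `C¹` and `Φ` of class
  `C²` on an open `Ω ⊇ {x} × [0, 1]`: `d(h(Φ^* β))(x) = Φ₁^* β (x) - Φ₀^* β (x)`;
* **`exists_extDeriv_eq_pullbackForm_sub_pullbackForm`** — on an open `U` with `U × [0, 1] ⊆ Ω` and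
  smooth data, `Φ₁^* β - Φ₀^* β = dη` on `U` with `η = h(Φ^* β)` smooth on `U`: homotopic maps pull a
  closed form back to cohomologous forms (the model case of Prop. 17.10, the analytic content of the
  tree's named fact `Literature.Geometry.Kaehler.deRhamCohomology.map_eq_of_homotopic` of
  `Literature/NumberTheory/Transcendental/DeRhamTheorem.lean`).

[cite: Lee2012, Ch. 17, Prop. 17.10 (proof) with Lemma 17.9]

## References

* J. M. Lee, *Introduction to Smooth Manifolds*, 2nd ed., GTM 218, Springer (2012), Ch. 17,
  Lemma 17.9 and Prop. 17.10. [Lee2012]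
-/

noncomputable section

open Set MeasureTheory intervalIntegral Filter Topology Function

namespace Literature.Analysis.Calculus

universe u v w

variable {E : Type u} [NormedAddCommGroup E] [NormedSpace ℝ E]
  {E' : Type w} [NormedAddCommGroup E'] [NormedSpace ℝ E']
  {F : Type v} [NormedAddCommGroup F] [NormedSpace ℝ F] {n : ℕ}

/-! ### The pull-back of a form along a map of normed spaces: regularity, slices, closedness -/

section Pullback

variable {G : Type*} [NormedAddCommGroup G] [NormedSpace ℝ G]
  {β : E' → E' [⋀^Fin n]→L[ℝ] F} {V : Set E'} {Φ : G → E'} {Ω : Set G}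

/-- **`Φ^* β` is `Cᵐ` where `Φ` is `Cᵐ⁺¹` and `β` is `Cᵐ`**: on an open `Ω` mapped by `Φ` into an open
set `V` on which `β` is `Cᵐ`, the pull-back `p ↦ (β (Φ p)) ∘ DΦ(p)` is `Cᵐ` (composition, the derivative
`DΦ` being `Cᵐ`, and the pull-back of alternating maps along linear maps being smooth in both
arguments). [cite: Lee2012, Ch. 17, Prop. 17.10 (proof)] -/
theorem contDiffOn_pullbackForm (hΩ : IsOpen Ω) {m : ℕ∞}
    (hΦ : ContDiffOn ℝ (m + 1) Φ Ω) (hΦV : MapsTo Φ Ω V) (hβ : ContDiffOn ℝ m β V) :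
    ContDiffOn ℝ m (fun p => (β (Φ p)).compContinuousLinearMap (fderiv ℝ Φ p)) Ω := by
  have h1 : ContDiffOn ℝ m (fun p => β (Φ p)) Ω :=
    hβ.comp (hΦ.of_le (by exact_mod_cast le_self_add)) hΦV
  have h2 : ContDiffOn ℝ m (fderiv ℝ Φ) Ω := hΦ.fderiv_of_isOpen hΩ le_rfl
  intro p hp
  exact Literature.NumberTheory.Transcendental.ContDiffWithinAt.continuousAlternatingMapCompContinuousLinearMap
    (h1 p hp) (h2 p hp)

end Pullback

section Slices

variable {β : E' → E' [⋀^Fin n]→L[ℝ] F} {Φ : E × ℝ → E'}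

/-- **`i_t^*(Φ^* β) = (Φ ∘ i_t)^* β`**: the slice at height `t` of the pull-back along `Φ` is the
pull-back along `Φₜ = Φ(·, t)` (chain rule, `D(Φ ∘ i_t)(x) = DΦ(x, t) ∘ (v ↦ (v, 0))`).
[cite: Lee2012, Ch. 17, Prop. 17.10 (proof)] -/
theorem pullbackForm_slice {x : E} {t : ℝ} (hΦ : DifferentiableAt ℝ Φ (x, t)) :
    ((β (Φ (x, t))).compContinuousLinearMap (fderiv ℝ Φ (x, t))).compContinuousLinearMap
        (ContinuousLinearMap.inl ℝ E ℝ) =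
      (β (Φ (x, t))).compContinuousLinearMap (fderiv ℝ (fun y : E => Φ (y, t)) x) := by
  have h : HasFDerivAt (fun y : E => Φ (y, t))
      ((fderiv ℝ Φ (x, t)).comp (ContinuousLinearMap.inl ℝ E ℝ)) x :=
    hΦ.hasFDerivAt.comp x (hasFDerivAt_prodMk_left x t)
  rw [h.fderiv]
  ext v
  rfl

end Slices

section Closed

variable {G : Type*} [NormedAddCommGroup G] [NormedSpace ℝ G]
  {β : E' → E' [⋀^Fin n]→L[ℝ] F} {V : Set E'} {Φ : G → E'} {Ω : Set G}

/-- **`d(Φ^* β) = 0` for a closed `β`**: at a point `p` of an open `Ω` on which `Φ` is `C²`, mapped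
into an open `V` on which `β` is `C¹` and closed, `d(Φ^* β)(p) = Φ^*(dβ)(p) = 0` (Mathlib's
`extDeriv_pullback`). [cite: Lee2012, Ch. 17, Prop. 17.10 (proof)] -/
theorem extDeriv_pullbackForm_eq_zero (hΩ : IsOpen Ω) (hV : IsOpen V) (hΦ : ContDiffOn ℝ 2 Φ Ω)
    (hΦV : MapsTo Φ Ω V) (hβ : ContDiffOn ℝ 1 β V) (hdβ : ∀ y ∈ V, extDeriv β y = 0) {p : G}
    (hp : p ∈ Ω) :
    extDeriv (fun q => (β (Φ q)).compContinuousLinearMap (fderiv ℝ Φ q)) p = 0 := by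
  have hβd : DifferentiableAt ℝ β (Φ p) :=
    (hβ.differentiableOn one_ne_zero _ (hΦV hp)).differentiableAt (hV.mem_nhds (hΦV hp))
  have hΦ2 : ContDiffAt ℝ 2 Φ p := hΦ.contDiffAt (hΩ.mem_nhds hp)
  rw [extDeriv_pullback hβd hΦ2 (by simp), hdβ _ (hΦV hp)]
  ext v
  rfl

end Closed

/-! ### Homotopic maps and the cylinder operator -/

section Homotopy

variable [CompleteSpace F] {β : E' → E' [⋀^Fin (n + 1)]→L[ℝ] F} {V : Set E'}
  {Φ : E × ℝ → E'} {Ω : Set (E × ℝ)}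

/-- **`d(h(Φ^* β))(x) = Φ₁^* β (x) - Φ₀^* β (x)`** (Lee, proof of Prop. 17.10: Lemma 17.9 applied to
`ω = Φ^* β`, which is closed): for `β` a closed `(n+1)`-form of class `C¹` on an open `V`, and a
homotopy `Φ` of class `C²` on an open `Ω ⊇ {x} × [0, 1]` with `Φ(Ω) ⊆ V`, the cylinder operator `h`
applied to `Φ^* β` is a primitive, at `x`, of the difference of the pull-backs along
`Φ₁ = Φ(·, 1)` and `Φ₀ = Φ(·, 0)`. [cite: Lee2012, Ch. 17, Prop. 17.10 (proof) with Lemma 17.9] -/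
theorem extDeriv_cylinderPrimitive_pullbackForm (hΩ : IsOpen Ω) (hV : IsOpen V)
    (hΦ : ContDiffOn ℝ 2 Φ Ω) (hΦV : MapsTo Φ Ω V) (hβ : ContDiffOn ℝ 1 β V)
    (hdβ : ∀ y ∈ V, extDeriv β y = 0) {x : E} (hx : ({x} : Set E) ×ˢ uIcc (0 : ℝ) 1 ⊆ Ω) :
    extDeriv (cylinderPrimitive fun p => (β (Φ p)).compContinuousLinearMap (fderiv ℝ Φ p)) x =
      (β (Φ (x, 1))).compContinuousLinearMap (fderiv ℝ (fun y : E => Φ (y, 1)) x) -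
        (β (Φ (x, 0))).compContinuousLinearMap (fderiv ℝ (fun y : E => Φ (y, 0)) x) := by
  have hω : ContDiffOn ℝ 1 (fun p => (β (Φ p)).compContinuousLinearMap (fderiv ℝ Φ p)) Ω :=
    contDiffOn_pullbackForm hΩ (m := 1) (by exact_mod_cast hΦ) hΦV hβ
  have hseg : ∀ t ∈ Icc (0 : ℝ) 1, (x, t) ∈ Ω := fun t ht =>
    hx (mk_mem_prod rfl (by rwa [uIcc_of_le zero_le_one]))
  have hclosed : ∀ t ∈ Icc (0 : ℝ) 1,
      extDeriv (fun p => (β (Φ p)).compContinuousLinearMap (fderiv ℝ Φ p)) (x, t) = 0 :=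
    fun t ht => extDeriv_pullbackForm_eq_zero hΩ hV hΦ hΦV hβ hdβ (hseg t ht)
  have hd : ∀ t ∈ Icc (0 : ℝ) 1, DifferentiableAt ℝ Φ (x, t) := fun t ht =>
    (hΦ.differentiableOn (by norm_num) _ (hseg t ht)).differentiableAt (hΩ.mem_nhds (hseg t ht))
  rw [extDeriv_cylinderPrimitive_of_closed hΩ hω hx hclosed,
    pullbackForm_slice (hd 1 ⟨zero_le_one, le_rfl⟩), pullbackForm_slice (hd 0 ⟨le_rfl, zero_le_one⟩)]

/-- **Homotopic maps pull a closed form back to cohomologous forms** (Lee, Prop. 17.10, model case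
on normed spaces): for `β` a closed smooth `(n+1)`-form on an open `V ⊆ E'` and a smooth homotopy
`Φ` on an open `Ω ⊆ E × ℝ` containing `U × [0, 1]`, `U` open, with `Φ(Ω) ⊆ V`, there is a smooth
`n`-form `η` on `U` — the cylinder operator applied to `Φ^* β` — with
`dη = Φ₁^* β - Φ₀^* β` on `U`. [cite: Lee2012, Ch. 17, Prop. 17.10 (proof) with Lemma 17.9] -/
theorem exists_extDeriv_eq_pullbackForm_sub_pullbackForm (hΩ : IsOpen Ω) (hV : IsOpen V)
    (hΦ : ContDiffOn ℝ (⊤ : ℕ∞) Φ Ω) (hΦV : MapsTo Φ Ω V) (hβ : ContDiffOn ℝ (⊤ : ℕ∞) β V)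
    (hdβ : ∀ y ∈ V, extDeriv β y = 0) {U : Set E} (hU : IsOpen U)
    (hUΩ : U ×ˢ uIcc (0 : ℝ) 1 ⊆ Ω) :
    ∃ η : E → E [⋀^Fin n]→L[ℝ] F, ContDiffOn ℝ (⊤ : ℕ∞) η U ∧ ∀ x ∈ U,
      extDeriv η x =
        (β (Φ (x, 1))).compContinuousLinearMap (fderiv ℝ (fun y : E => Φ (y, 1)) x) -
          (β (Φ (x, 0))).compContinuousLinearMap (fderiv ℝ (fun y : E => Φ (y, 0)) x) := by
  have hω : ContDiffOn ℝ (⊤ : ℕ∞) (fun p => (β (Φ p)).compContinuousLinearMap (fderiv ℝ Φ p)) Ω :=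
    contDiffOn_pullbackForm hΩ (m := ⊤) (by simpa using hΦ) hΦV hβ
  refine ⟨cylinderPrimitive fun p => (β (Φ p)).compContinuousLinearMap (fderiv ℝ Φ p),
    contDiffOn_cylinderPrimitive hΩ hω hU hUΩ, fun x hx => ?_⟩
  exact extDeriv_cylinderPrimitive_pullbackForm hΩ hV
    (hΦ.of_le (WithTop.coe_le_coe.mpr le_top)) hΦV (hβ.of_le (WithTop.coe_le_coe.mpr le_top)) hdβ
    ((prod_mono (singleton_subset_iff.2 hx) Subset.rfl).trans hUΩ)

end Homotopy

end Literature.Analysis.Calculus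

end
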